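import Summits.Ventures.LatticeQCDFlow.Exactness.IMHColdStartPathAverage
import Summits.Ventures.LatticeQCDFlow.Scoring.ReplicaChains
import HarnessLib

/-!
# The cold start, second order: the bias floor of a cold-started flow-MCMC time average, and what parallel
# cold-started replicas can and cannot do

HONEST FRAMING: exact (Metropolis-corrected) sampling algorithms for lattice gauge theory;
figures of merit are autocorrelation/cost numbers at stated couplings and volumes; no
continuum-physics claim.

Venture `LatticeQCDFlow` (cell pub-lqcd), topic `Exactness`; FANOUT row 30 (lean-1, GEN-32).  NEW WORK of the
cell, general state space.  Setting of `IMHColdStartMSE` (this generation): `K = indepMH q w`, `w` normalised,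
maximal at `x₀`, `r = 1 − 1/w(x₀)`, `f` bounded measurable, `δ = f(x₀) − π f`, `S_N = Σ_{t<N} r^t`,
`A_N = (1/N)Σ_{i<N} f(X_i)`, `MSE_{x₀}(N) = E_{x₀}[(A_N − π f)²]`.  Flow-based samplers are run as MANY PARALLEL
CHAINS (batched proposals on an accelerator); the Scoring row priced the grand mean of `R` replicas of ANY Doeblin
chain by certificates (`Scoring/ReplicaChains`: `≤ MSE_N/R + (1 − 1/R)·bias_N²`).  For cold-started flow-MCMC
the bias is known EXACTLY (GEN-31: `E_{x₀} A_N − π f = δ·S_N/N`), so: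

* §1 **`imh_chain_mse_mode_ge_bias_sq`** — ONE CHAIN: `MSE_{x₀}(N) ≥ (δ·S_N/N)²` (Jensen on the exact bias), and
  **`imh_chain_mse_mode_ge_floor`** — `≥ δ²/(1 + N/w(x₀))²`: whatever its fluctuations, a cold-started run of
  length `N` cannot estimate `π f` to root-mean-square accuracy better than `|δ|/(1 + N·A(x₀))`, `A(x₀) = 1/w(x₀)`
  the acceptance at the cold configuration.
* §2 REPLICAS, on any probability space carrying real random variables `Y_0, …, Y_{R−1}` (`R ≥ 1`) each with the
  mean of the cold-started time average, `E Y_r = π f + δ·S_N/N` — the replicas may be arbitrarily correlated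
  (shared proposals, common random numbers) and need not even be chains:
  **`replicaMean_coldStart_mse_ge`** — `E (Ȳ − π f)² ≥ (δ·S_N/N)²` (`Ȳ = Scoring.replicaMean Y R`), and
  **`replicaMean_coldStart_mse_ge_floor`** — `≥ δ²/(1 + N/w(x₀))²`: REPLICATION DIVIDES THE FLUCTUATION, NEVER THE
  COLD-START BIAS; **`replicas_length_necessary`** — if the grand mean reaches mean-square accuracy `ε²` then
  `(|δ|/ε − 1)·w(x₀) ≤ N`: EVERY replica must itself be longer than `(|δ|/ε − 1)/A(x₀)`, however many replicas run.
* §3 **`replicaMean_coldStart_mse_le`** — and the other side for UNCORRELATED replicas each distributed like the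
  cold-started time average in mean and mean square (`E Y_r = π f + δ S_N/N`, `E (Y_r − π f)² = MSE_{x₀}(N)`):
  `E (Ȳ − π f)² ≤ MSE_{x₀}(N)/R + (1 − 1/R)·(δ·S_N/N)²` (the Scoring row's `integral_replicaMean_sub_sq_le` with the
  exact bias) — so (**`replicaMean_coldStart_mse_two_sided`**) the grand mean's error is pinned between
  `(δ S_N/N)²` and `(δ S_N/N)² + MSE_{x₀}(N)/R`: AS `R → ∞` THE ERROR OF COLD-STARTED PARALLEL FLOW-MCMC IS EXACTLY
  THE SQUARED BIAS `(δ·S_N/N)²`, `S_N = w(x₀)(1 − r^N) ∈ [N/(1 + N/w(x₀)), min(N, w(x₀))]`.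

Reading (gauge files): with `1/w(cold) = A = Z/(c^{#B}M^k)` resp. `Z/∏_ℓ c_{#C_ℓ}`, a farm of cold-started exact
gauge samplers of length `N` estimates every observable with `f(cold) ≠ π f` no better than `|δf|/(1 + N·A)` in
root mean square; on `(ℤ/L)²` `N ≥ (|δf|/ε − 1)·M/m` per replica suffices for the bias side, in `d = 3` the
necessary per-replica length is `(|δf|/ε − 1)·θ₁^{−s}`, `3s ≥ L³ + 2` (`Scaling/AutoregressiveGaugeColdLawDimension`).
NOT CLAIMED: anything about warm or hot-started replicas (their bias is not signed); the variance side beyond the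
Scoring row's certificate; confidence statements.

No `sorry`, no new definitions, nothing cited as a fact; general measurable space with measurable singletons.
-/

noncomputable section

namespace Summit.Ventures.LatticeQCDFlow.Exactness

open MeasureTheory ProbabilityTheory Function Finset
open scoped ENNReal
open Summit.Ventures.LatticeQCDFlow.Scoring

variable {Ω : Type*} [MeasurableSpace Ω] [MeasurableSingletonClass Ω]
variable {q : Measure Ω} [IsProbabilityMeasure q] {w : Ω → ℝ}

/-! ## §1 One chain: the squared bias is a floor -/

/-- **`MSE_{x₀}(N) ≥ (bias)² = (δ·S_N/N)²`**, `S_N = Σ_{t<N} r^t` — Jensen on GEN-31's exact bias. [ours] -/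
theorem imh_chain_mse_mode_ge_bias_sq [Fact (Measurable w)] (hw0 : ∀ y, 0 < w y) {x₀ : Ω}
    (hmax : ∀ y, w y ≤ w x₀) [IsProbabilityMeasure (q.withDensity fun y => ENNReal.ofReal (w y))]
    {f : Ω → ℝ} (hf : Measurable f) {C : ℝ} (hC : ∀ x, |f x| ≤ C) {N : ℕ} (hN : N ≠ 0) :
    ((f x₀ - ∫ z, f z ∂(q.withDensity fun y => ENNReal.ofReal (w y))) *
        (∑ t ∈ Finset.range N, (1 - (w x₀)⁻¹) ^ t) / N) ^ 2 ≤
      ∫ x, ((∑ i ∈ Finset.range N, f (x i)) / N - ∫ z, f z ∂(q.withDensity fun y => ENNReal.ofReal (w y))) ^ 2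
        ∂(Kernel.trajMeasure (X := fun _ : ℕ => Ω) (Measure.dirac x₀)
          (fun n : ℕ => (indepMH q w).comap (fun h : (i : ↥(Finset.Iic n)) → Ω => h ⟨n, Finset.mem_Iic.2 le_rfl⟩)
            (measurable_pi_apply _))) := by
  set P := Kernel.trajMeasure (X := fun _ : ℕ => Ω) (Measure.dirac x₀)
      (fun n : ℕ => (indepMH q w).comap (fun h : (i : ↥(Finset.Iic n)) → Ω => h ⟨n, Finset.mem_Iic.2 le_rfl⟩)
        (measurable_pi_apply _)) with hP
  set m := ∫ z, f z ∂(q.withDensity fun y => ENNReal.ofReal (w y)) with hm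
  have hNpos : (0 : ℝ) < N := by exact_mod_cast Nat.pos_of_ne_zero hN
  have hAb : ∀ x : ℕ → Ω, |(∑ i ∈ Finset.range N, f (x i)) / N| ≤ C := fun x => by
    rw [abs_div, abs_of_pos hNpos, div_le_iff₀ hNpos]
    calc |∑ i ∈ Finset.range N, f (x i)| ≤ ∑ i ∈ Finset.range N, |f (x i)| := abs_sum_le_sum_abs _ _
      _ ≤ ∑ _i ∈ Finset.range N, C := sum_le_sum fun i _ => hC (x i)
      _ = C * N := by rw [sum_const, card_range, nsmul_eq_mul, mul_comm]
  have hAm : Measurable fun x : ℕ → Ω => (∑ i ∈ Finset.range N, f (x i)) / N :=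
    (Finset.measurable_sum _ fun i _ => hf.comp (measurable_pi_apply i)).div_const _
  have hgm : Measurable fun x : ℕ → Ω => (∑ i ∈ Finset.range N, f (x i)) / N - m := hAm.sub measurable_const
  have hgb : ∀ x : ℕ → Ω, |(∑ i ∈ Finset.range N, f (x i)) / N - m| ≤ C + |m| := fun x =>
    (abs_sub _ _).trans (add_le_add (hAb x) le_rfl)
  have hint : Integrable (fun x : ℕ → Ω => (∑ i ∈ Finset.range N, f (x i)) / N) P :=
    integrable_of_bounded P hAm hAb
  have hbias : ∫ x, ((∑ i ∈ Finset.range N, f (x i)) / N - m) ∂P =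
      (f x₀ - m) * (∑ t ∈ Finset.range N, (1 - (w x₀)⁻¹) ^ t) / N := by
    rw [integral_sub hint (integrable_const _), integral_const, probReal_univ, one_smul, hP, hm]
    exact imh_chain_timeAverage_bias_mode_eq hw0 hmax hf hC hN
  rw [← hbias]
  exact sq_integral_le_integral_sq P hgm hgb

/-- **`MSE_{x₀}(N) ≥ δ²/(1 + N/w(x₀))²**: whatever the fluctuations, a cold-started run of length `N` cannot
estimate `π f` to mean-square accuracy better than `|δ|/(1 + N·A(x₀))`, `A(x₀) = 1/w(x₀)` (`N ≥ 1`). [ours] -/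
theorem imh_chain_mse_mode_ge_floor [Fact (Measurable w)] (hw0 : ∀ y, 0 < w y) {x₀ : Ω}
    (hmax : ∀ y, w y ≤ w x₀) [IsProbabilityMeasure (q.withDensity fun y => ENNReal.ofReal (w y))]
    {f : Ω → ℝ} (hf : Measurable f) {C : ℝ} (hC : ∀ x, |f x| ≤ C) {N : ℕ} (hN : N ≠ 0) :
    (f x₀ - ∫ z, f z ∂(q.withDensity fun y => ENNReal.ofReal (w y))) ^ 2 / (1 + N * (w x₀)⁻¹) ^ 2 ≤
      ∫ x, ((∑ i ∈ Finset.range N, f (x i)) / N - ∫ z, f z ∂(q.withDensity fun y => ENNReal.ofReal (w y))) ^ 2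
        ∂(Kernel.trajMeasure (X := fun _ : ℕ => Ω) (Measure.dirac x₀)
          (fun n : ℕ => (indepMH q w).comap (fun h : (i : ↥(Finset.Iic n)) → Ω => h ⟨n, Finset.mem_Iic.2 le_rfl⟩)
            (measurable_pi_apply _))) := by
  have hNpos : (0 : ℝ) < N := by exact_mod_cast Nat.pos_of_ne_zero hN
  have hWpos : 0 < w x₀ := hw0 x₀
  refine le_trans ?_ (imh_chain_mse_mode_ge_bias_sq hw0 hmax hf hC hN)
  have hge := geom_sum_mode_ge (q := q) hw0 hmax N (x₀ := x₀)
  have hS : 1 / (1 + N * (w x₀)⁻¹) ≤ (∑ t ∈ Finset.range N, (1 - (w x₀)⁻¹) ^ t) / N := by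
    rw [le_div_iff₀ hNpos]
    calc 1 / (1 + N * (w x₀)⁻¹) * N = N / (1 + N * (w x₀)⁻¹) := by ring
      _ ≤ _ := hge
  have hS0 : 0 ≤ 1 / (1 + N * (w x₀)⁻¹) := by positivity
  calc (f x₀ - ∫ z, f z ∂(q.withDensity fun y => ENNReal.ofReal (w y))) ^ 2 / (1 + N * (w x₀)⁻¹) ^ 2
      = (f x₀ - ∫ z, f z ∂(q.withDensity fun y => ENNReal.ofReal (w y))) ^ 2 * (1 / (1 + N * (w x₀)⁻¹)) ^ 2 := by
        rw [one_div_pow, ← div_eq_mul_one_div]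
    _ ≤ (f x₀ - ∫ z, f z ∂(q.withDensity fun y => ENNReal.ofReal (w y))) ^ 2 *
          ((∑ t ∈ Finset.range N, (1 - (w x₀)⁻¹) ^ t) / N) ^ 2 :=
        mul_le_mul_of_nonneg_left (pow_le_pow_left₀ hS0 hS 2) (sq_nonneg _)
    _ = _ := by rw [← mul_pow, mul_div_assoc]

/-! ## §2 Replicas: the bias is common, so it survives every average -/

section Replicas

variable {Ω' : Type*} {mΩ' : MeasurableSpace Ω'} {μ : Measure Ω'} [IsProbabilityMeasure μ]
variable {Y : ℕ → Ω' → ℝ} {R : ℕ}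

omit [MeasurableSingletonClass Ω] [IsProbabilityMeasure q] in
/-- **REPLICATION NEVER DIVIDES THE COLD-START BIAS.**  On any probability space, `R ≥ 1` square-integrable real
random variables (arbitrarily dependent) each with mean `π f + δ·S_N/N` — the mean of the cold-started flow-MCMC
time average of length `N` — have a grand mean `Ȳ` with `E (Ȳ − π f)² ≥ (δ·S_N/N)²`. [ours] -/
theorem replicaMean_coldStart_mse_ge (hR : R ≠ 0) (hY : ∀ r < R, MemLp (Y r) 2 μ) {x₀ : Ω} {f : Ω → ℝ} {N : ℕ}
    (hmean : ∀ r < R, μ[Y r] = ∫ z, f z ∂(q.withDensity fun y => ENNReal.ofReal (w y)) +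
      (f x₀ - ∫ z, f z ∂(q.withDensity fun y => ENNReal.ofReal (w y))) *
        (∑ t ∈ Finset.range N, (1 - (w x₀)⁻¹) ^ t) / N) :
    ((f x₀ - ∫ z, f z ∂(q.withDensity fun y => ENNReal.ofReal (w y))) *
        (∑ t ∈ Finset.range N, (1 - (w x₀)⁻¹) ^ t) / N) ^ 2 ≤
      ∫ ω, (replicaMean Y R ω - ∫ z, f z ∂(q.withDensity fun y => ENNReal.ofReal (w y))) ^ 2 ∂μ := by
  have hRpos : (0 : ℝ) < R := by exact_mod_cast Nat.pos_of_ne_zero hR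
  set m := ∫ z, f z ∂(q.withDensity fun y => ENNReal.ofReal (w y)) with hm
  set b := (f x₀ - m) * (∑ t ∈ Finset.range N, (1 - (w x₀)⁻¹) ^ t) / N with hb
  have hEY : μ[replicaMean Y R] = m + b := by
    rw [integral_replicaMean hY, Finset.sum_congr rfl fun r hr => hmean r (Finset.mem_range.1 hr), sum_const,
      card_range, nsmul_eq_mul]
    field_simp
  rw [integral_sub_const_sq (memLp_replicaMean hY) m, hEY, add_sub_cancel_left]
  linarith [variance_nonneg (replicaMean Y R) μ]

omit [MeasurableSingletonClass Ω] in
/-- **`E (Ȳ − π f)² ≥ δ²/(1 + N/w(x₀))²`** for the grand mean of any number of (arbitrarily dependent) replicas with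
the cold-started mean (`N ≥ 1`; `w` normalised, maximal at `x₀`). [ours] -/
theorem replicaMean_coldStart_mse_ge_floor (hw0 : ∀ y, 0 < w y) {x₀ : Ω} (hmax : ∀ y, w y ≤ w x₀)
    [IsProbabilityMeasure (q.withDensity fun y => ENNReal.ofReal (w y))]
    (hR : R ≠ 0) (hY : ∀ r < R, MemLp (Y r) 2 μ) {f : Ω → ℝ} {N : ℕ} (hN : N ≠ 0)
    (hmean : ∀ r < R, μ[Y r] = ∫ z, f z ∂(q.withDensity fun y => ENNReal.ofReal (w y)) +
      (f x₀ - ∫ z, f z ∂(q.withDensity fun y => ENNReal.ofReal (w y))) *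
        (∑ t ∈ Finset.range N, (1 - (w x₀)⁻¹) ^ t) / N) :
    (f x₀ - ∫ z, f z ∂(q.withDensity fun y => ENNReal.ofReal (w y))) ^ 2 / (1 + N * (w x₀)⁻¹) ^ 2 ≤
      ∫ ω, (replicaMean Y R ω - ∫ z, f z ∂(q.withDensity fun y => ENNReal.ofReal (w y))) ^ 2 ∂μ := by
  have hNpos : (0 : ℝ) < N := by exact_mod_cast Nat.pos_of_ne_zero hN
  have hWpos : 0 < w x₀ := hw0 x₀
  refine le_trans ?_ (replicaMean_coldStart_mse_ge (q := q) (w := w) hR hY hmean)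
  have hge := geom_sum_mode_ge (q := q) hw0 hmax N (x₀ := x₀)
  have hS : 1 / (1 + N * (w x₀)⁻¹) ≤ (∑ t ∈ Finset.range N, (1 - (w x₀)⁻¹) ^ t) / N := by
    rw [le_div_iff₀ hNpos]
    calc 1 / (1 + N * (w x₀)⁻¹) * N = N / (1 + N * (w x₀)⁻¹) := by ring
      _ ≤ _ := hge
  have hS0 : 0 ≤ 1 / (1 + N * (w x₀)⁻¹) := by positivity
  calc (f x₀ - ∫ z, f z ∂(q.withDensity fun y => ENNReal.ofReal (w y))) ^ 2 / (1 + N * (w x₀)⁻¹) ^ 2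
      = (f x₀ - ∫ z, f z ∂(q.withDensity fun y => ENNReal.ofReal (w y))) ^ 2 * (1 / (1 + N * (w x₀)⁻¹)) ^ 2 := by
        rw [one_div_pow, ← div_eq_mul_one_div]
    _ ≤ (f x₀ - ∫ z, f z ∂(q.withDensity fun y => ENNReal.ofReal (w y))) ^ 2 *
          ((∑ t ∈ Finset.range N, (1 - (w x₀)⁻¹) ^ t) / N) ^ 2 :=
        mul_le_mul_of_nonneg_left (pow_le_pow_left₀ hS0 hS 2) (sq_nonneg _)
    _ = _ := by rw [← mul_pow, mul_div_assoc]

omit [MeasurableSingletonClass Ω] in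
/-- **EVERY REPLICA MUST ITSELF OUTLIVE THE COLD START**: if the grand mean of replicas with the cold-started mean
reaches `E (Ȳ − π f)² ≤ ε²` (`ε > 0`, `N ≥ 1`), then `(|δ|/ε − 1)·w(x₀) ≤ N` — whatever the number of replicas.
[ours] -/
theorem replicas_length_necessary (hw0 : ∀ y, 0 < w y) {x₀ : Ω} (hmax : ∀ y, w y ≤ w x₀)
    [IsProbabilityMeasure (q.withDensity fun y => ENNReal.ofReal (w y))]
    (hR : R ≠ 0) (hY : ∀ r < R, MemLp (Y r) 2 μ) {f : Ω → ℝ} {N : ℕ} (hN : N ≠ 0)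
    (hmean : ∀ r < R, μ[Y r] = ∫ z, f z ∂(q.withDensity fun y => ENNReal.ofReal (w y)) +
      (f x₀ - ∫ z, f z ∂(q.withDensity fun y => ENNReal.ofReal (w y))) *
        (∑ t ∈ Finset.range N, (1 - (w x₀)⁻¹) ^ t) / N)
    {ε : ℝ} (hε : 0 < ε)
    (hacc : ∫ ω, (replicaMean Y R ω - ∫ z, f z ∂(q.withDensity fun y => ENNReal.ofReal (w y))) ^ 2 ∂μ ≤ ε ^ 2) :
    (|f x₀ - ∫ z, f z ∂(q.withDensity fun y => ENNReal.ofReal (w y))| / ε - 1) * w x₀ ≤ N := by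
  have hNpos : (0 : ℝ) < N := by exact_mod_cast Nat.pos_of_ne_zero hN
  have hWpos : 0 < w x₀ := hw0 x₀
  have hD : 0 < 1 + N * (w x₀)⁻¹ := by positivity
  set δ := f x₀ - ∫ z, f z ∂(q.withDensity fun y => ENNReal.ofReal (w y)) with hδ
  have h1 : δ ^ 2 / (1 + N * (w x₀)⁻¹) ^ 2 ≤ ε ^ 2 :=
    (replicaMean_coldStart_mse_ge_floor (q := q) hw0 hmax hR hY hN hmean).trans hacc
  -- `|δ|/(1 + N/w) ≤ ε`
  have h2 : |δ| / (1 + N * (w x₀)⁻¹) ≤ ε := by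
    have h3 : (|δ| / (1 + N * (w x₀)⁻¹)) ^ 2 ≤ ε ^ 2 := by rwa [div_pow, sq_abs]
    exact (pow_le_pow_iff_left₀ (by positivity) hε.le two_ne_zero).1 h3
  rw [div_le_iff₀ hD] at h2
  rw [sub_mul, div_mul_eq_mul_div, sub_le_iff_le_add, div_le_iff₀ hε]
  have h4 : |δ| * w x₀ ≤ ε * (1 + N * (w x₀)⁻¹) * w x₀ := mul_le_mul_of_nonneg_right h2 hWpos.le
  have h5 : ε * (1 + N * (w x₀)⁻¹) * w x₀ = (N + 1 * w x₀) * ε := by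
    field_simp
    ring
  linarith [h4, h5]

/-! ## §3 Uncorrelated replicas: the other side, with the exact bias -/

omit [MeasurableSingletonClass Ω] [IsProbabilityMeasure q] in
/-- **Uncorrelated replicas of the cold-started run**: if `Y_0, …, Y_{R−1}` are pairwise uncorrelated, each with the
cold-started mean `π f + δ S_N/N` and mean square error at most `v` about `π f`, then
`E (Ȳ − π f)² ≤ v/R + (1 − 1/R)·(δ·S_N/N)²` — the Scoring row's replica certificate with the EXACT bias. [ours] -/
theorem replicaMean_coldStart_mse_le (hR : R ≠ 0) (hY : ∀ r < R, MemLp (Y r) 2 μ)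
    (hcov : ∀ i < R, ∀ j < R, i ≠ j → cov[Y i, Y j; μ] = 0) {x₀ : Ω} {f : Ω → ℝ} {N : ℕ}
    (hmean : ∀ r < R, μ[Y r] = ∫ z, f z ∂(q.withDensity fun y => ENNReal.ofReal (w y)) +
      (f x₀ - ∫ z, f z ∂(q.withDensity fun y => ENNReal.ofReal (w y))) *
        (∑ t ∈ Finset.range N, (1 - (w x₀)⁻¹) ^ t) / N)
    {v : ℝ} (hv : ∀ r < R, ∫ ω, (Y r ω - ∫ z, f z ∂(q.withDensity fun y => ENNReal.ofReal (w y))) ^ 2 ∂μ ≤ v) :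
    ∫ ω, (replicaMean Y R ω - ∫ z, f z ∂(q.withDensity fun y => ENNReal.ofReal (w y))) ^ 2 ∂μ ≤
      v / R + (1 - 1 / R) * ((f x₀ - ∫ z, f z ∂(q.withDensity fun y => ENNReal.ofReal (w y))) *
        (∑ t ∈ Finset.range N, (1 - (w x₀)⁻¹) ^ t) / N) ^ 2 := by
  refine (integral_replicaMean_sub_sq_le hR hY hcov
    (b := |(f x₀ - ∫ z, f z ∂(q.withDensity fun y => ENNReal.ofReal (w y))) *
        (∑ t ∈ Finset.range N, (1 - (w x₀)⁻¹) ^ t) / N|) (fun r hr => ?_) hv).trans_eq ?_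
  · rw [hmean r hr, add_sub_cancel_left]
  · rw [sq_abs]

omit [MeasurableSingletonClass Ω] [IsProbabilityMeasure q] in
/-- **TWO-SIDED FOR UNCORRELATED COLD-STARTED REPLICAS**: `(δ S_N/N)² ≤ E (Ȳ − π f)² ≤ (δ S_N/N)² + v/R` — as
`R → ∞` the grand mean's error is EXACTLY the squared cold-start bias. [ours] -/
theorem replicaMean_coldStart_mse_two_sided (hR : R ≠ 0) (hY : ∀ r < R, MemLp (Y r) 2 μ)
    (hcov : ∀ i < R, ∀ j < R, i ≠ j → cov[Y i, Y j; μ] = 0) {x₀ : Ω} {f : Ω → ℝ} {N : ℕ}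
    (hmean : ∀ r < R, μ[Y r] = ∫ z, f z ∂(q.withDensity fun y => ENNReal.ofReal (w y)) +
      (f x₀ - ∫ z, f z ∂(q.withDensity fun y => ENNReal.ofReal (w y))) *
        (∑ t ∈ Finset.range N, (1 - (w x₀)⁻¹) ^ t) / N)
    {v : ℝ} (hv : ∀ r < R, ∫ ω, (Y r ω - ∫ z, f z ∂(q.withDensity fun y => ENNReal.ofReal (w y))) ^ 2 ∂μ ≤ v) :
    ((f x₀ - ∫ z, f z ∂(q.withDensity fun y => ENNReal.ofReal (w y))) *
        (∑ t ∈ Finset.range N, (1 - (w x₀)⁻¹) ^ t) / N) ^ 2 ≤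
      ∫ ω, (replicaMean Y R ω - ∫ z, f z ∂(q.withDensity fun y => ENNReal.ofReal (w y))) ^ 2 ∂μ ∧
    ∫ ω, (replicaMean Y R ω - ∫ z, f z ∂(q.withDensity fun y => ENNReal.ofReal (w y))) ^ 2 ∂μ ≤
      ((f x₀ - ∫ z, f z ∂(q.withDensity fun y => ENNReal.ofReal (w y))) *
        (∑ t ∈ Finset.range N, (1 - (w x₀)⁻¹) ^ t) / N) ^ 2 + v / R := by
  have hRpos : (0 : ℝ) < R := by exact_mod_cast Nat.pos_of_ne_zero hR
  have hv0 : 0 ≤ v := (integral_nonneg fun ω => sq_nonneg _).trans (hv 0 (Nat.pos_of_ne_zero hR))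
  refine ⟨replicaMean_coldStart_mse_ge (q := q) (w := w) hR hY hmean,
    (replicaMean_coldStart_mse_le (q := q) (w := w) hR hY hcov hmean hv).trans ?_⟩
  have h1 : (1 - 1 / (R : ℝ)) * ((f x₀ - ∫ z, f z ∂(q.withDensity fun y => ENNReal.ofReal (w y))) *
        (∑ t ∈ Finset.range N, (1 - (w x₀)⁻¹) ^ t) / N) ^ 2 ≤
      ((f x₀ - ∫ z, f z ∂(q.withDensity fun y => ENNReal.ofReal (w y))) *
        (∑ t ∈ Finset.range N, (1 - (w x₀)⁻¹) ^ t) / N) ^ 2 := by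
    have h2 : 1 - 1 / (R : ℝ) ≤ 1 := sub_le_self _ (by positivity)
    exact (mul_le_mul_of_nonneg_right h2 (sq_nonneg _)).trans_eq (one_mul _)
  linarith

end Replicas

end Summit.Ventures.LatticeQCDFlow.Exactness
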